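import Literature.Analysis.FluidPDE.LeiZhang2011LocalSwirlBound
import Literature.Analysis.FluidPDE.LeiZhang2011
import Literature.Analysis.FluidPDE.AxisymSwirlL2Bound
import Literature.Analysis.FluidPDE.AxisymmetricVorticityTransport
import Literature.Analysis.FluidPDE.TaoEnstrophyLocalisation
import HarnessLib

/-!
# Lei–Zhang 2011, Theorem 1.4 — the local bound on `Γ = r u^θ` for classical solutions

Analysis/FluidPDE **proofs file** (theorems only: no definitions, no named facts, no `sorry`)
on the discharge path of `Literature.Analysis.FluidPDE.LeiZhang2011_regularity_bmoStream`
(Z. Lei, Q. S. Zhang, J. Funct. Anal. 261 (2011) = arXiv:1011.5066, **Theorem 1.4**). The local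
maximum estimate for the swirl on a slab (`LeiZhang2011.abs_le_of_slab`, from (2.6) of the
paper at the energy exponent `10/3`) is fed with the swirl `Γ(t, ·) = swirl (u t)` of a classical
axisymmetric solution of the unforced Navier–Stokes system (`ν = 1`) on an open time interval
carrying a stream function with `BMO` slices:

* `LeiZhang2011.swirl_slab_hypotheses` — on every slab `[τ − R², τ] ⊆ (α, β)`, `Γ` satisfies the
  hypotheses of `bundle_of_swirl_setting_slab`: `C²` axisymmetric slices vanishing on the axis,
  joint continuity of `Γ`, `∇Γ`, `ΔΓ` and of `u` (`IsTaoSolutionOn.isSmoothSpaceTimeOn_swirl`),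
  the stream
  function, and the swirl equation `∂ₜΓ + u·∇Γ = ΔΓ − (2/r)∂ᵣΓ` off the axis
  (`swirl_transport_holds`) integrated in time;
* `LeiZhang2011.abs_swirl_le_local_of_classical` — hence
  `|Γ(t, x)| ≤ C(K) R^{-3/2} ‖Γ‖_{L^{10/3}((τ−R²,τ]×B̄(0,R))}` for `t ∈ (τ − R²/4, τ)`,
  `x ∈ B(0, R/2)`, with `C` depending only on the `BMO` bound `K` — in particular **not** on
  `sup |u|`, so that the bound survives up to a (potential) singular time `β`.

## References

* Z. Lei, Q. S. Zhang, J. Funct. Anal. 261 (2011) = arXiv:1011.5066, §2 (2.6) and §4, proof of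
  Thm. 1.4 ("by … the maximum principle", p. 12). [LeiZhang2011]
-/

noncomputable section

open MeasureTheory Set Function Filter Metric intervalIntegral InnerProductSpace
open _root_.Topology
open scoped InnerProductSpace RealInnerProductSpace NNReal ENNReal Laplacian

namespace Literature.Analysis.FluidPDE

namespace LeiZhang2011

open Literature.Analysis.FunctionSpaces

set_option maxHeartbeats 400000 in
-- a long bookkeeping proof
/-- **The swirl of a classical axisymmetric solution on a slab is in the slab setting.** Let
`(u, p)` be a classical solution of the unforced Navier–Stokes system (`ν = 1`) on the open time
interval `(α, β)` with axisymmetric slices, a stream function with `BMO` slices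
(`HasBMOStreamFunctionOn (Ioo α β) u B K`), and let `[τ − R², τ] ⊆ (α, β)` with
`‖u‖ ≤ C_u` on `[τ − R², τ] × ℝ³`. Then `f(t) = swirl (u t)` satisfies the hypotheses of
`bundle_of_swirl_setting_slab` on `[τ − R², τ]`, the equation being the swirl equation
`∂ₜΓ + u·∇Γ = ΔΓ − (2/r)∂ᵣΓ` (`swirl_transport_holds`) integrated in time off the axis.
[cite: LeiZhang2011, (1.5) (arXiv p. 2) and §4] -/
theorem swirl_slab_hypotheses {α β : ℝ}
    {u : ℝ → EuclideanSpace ℝ (Fin 3) → EuclideanSpace ℝ (Fin 3)}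
    {p : ℝ → EuclideanSpace ℝ (Fin 3) → ℝ} (h : IsClassicalNSSolutionOn (Ioo α β) 1 0 u p)
    (haxi : ∀ t ∈ Ioo α β, IsAxisymmetric (u t))
    {B : ℝ → EuclideanSpace ℝ (Fin 3) → EuclideanSpace ℝ (Fin 3)} {K : ℝ≥0}
    (hB : HasBMOStreamFunctionOn (Ioo α β) u B K)
    {τ R : ℝ} (hsub : Icc (τ - R ^ 2) τ ⊆ Ioo α β) :
    (∀ t ∈ Icc (τ - R ^ 2) τ, ContDiff ℝ 2 (swirl (u t))) ∧
    ContinuousOn (fun q : ℝ × EuclideanSpace ℝ (Fin 3) => swirl (u q.1) q.2)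
      (Icc (τ - R ^ 2) τ ×ˢ univ) ∧
    ContinuousOn (fun q : ℝ × EuclideanSpace ℝ (Fin 3) => fderiv ℝ (swirl (u q.1)) q.2)
      (Icc (τ - R ^ 2) τ ×ˢ univ) ∧
    ContinuousOn (fun q : ℝ × EuclideanSpace ℝ (Fin 3) => (Δ (swirl (u q.1))) q.2)
      (Icc (τ - R ^ 2) τ ×ˢ univ) ∧
    (∀ t ∈ Icc (τ - R ^ 2) τ, IsAxisymmetricScalar (swirl (u t))) ∧
    (∀ t ∈ Icc (τ - R ^ 2) τ, ∀ x, cylRadius x = 0 → swirl (u t) x = 0) ∧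
    ContinuousOn (uncurry u) (Icc (τ - R ^ 2) τ ×ˢ univ) ∧
    (∀ᵐ t ∂((volume : Measure ℝ).restrict (Icc (τ - R ^ 2) τ)),
      Differentiable ℝ (B t) ∧ curl (B t) =ᵐ[volume] u t ∧ eBMOSeminormVec (B t) ≤ K) ∧
    (∀ x, cylRadius x ≠ 0 → ∀ s t : ℝ, τ - R ^ 2 ≤ s → s ≤ t → t ≤ τ →
      swirl (u t) x - swirl (u s) x = ∫ σ in s..t, ((Δ (swirl (u σ))) x -
        fderiv ℝ (swirl (u σ)) x (u σ x) -
          2 / cylRadius x * partialDeriv (eR x) (swirl (u σ)) x)) := by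
  have hS : UniqueDiffOn ℝ (Ioo α β) := uniqueDiffOn_Ioo α β
  have hsm : IsSmoothSpaceTimeOn (Ioo α β) u := h.smooth_velocity
  have hsw : IsSmoothSpaceTimeOn (Ioo α β) fun t => swirl (u t) :=
    IsTaoSolutionOn.isSmoothSpaceTimeOn_swirl hsm
  have hsub' : Icc (τ - R ^ 2) τ ×ˢ (univ : Set (EuclideanSpace ℝ (Fin 3))) ⊆ Ioo α β ×ˢ univ :=
    prod_mono hsub Subset.rfl
  -- the pressure is axisymmetric, so the swirl equation holds off the axis
  have hpax : ∀ t ∈ Ioo α β, IsAxisymmetricScalar (p t) := fun t ht =>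
    h.isAxisymmetricScalar_pressure hS haxi (fun t _ => isAxisymmetric_zero) ht
  refine ⟨fun t ht => contDiff_swirl ((h.contDiff_velocity (hsub ht)).of_le (by norm_cast)),
    hsw.continuousOn.mono hsub', (hsw.fderiv_slice hS).continuousOn.mono hsub',
    (hsw.laplacian hS).continuousOn.mono hsub',
    fun t ht => (haxi t (hsub ht)).isAxisymmetricScalar_swirl,
    fun t _ x hx => swirl_eq_zero_of_cylRadius_eq_zero (u t) hx,
    hsm.continuousOn.mono hsub', ?_, ?_⟩
  · exact (ae_restrict_iff' measurableSet_Icc).2 (Eventually.of_forall fun t ht => hB t (hsub ht))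
  · intro x hx s t hs hst ht
    -- the swirl equation at the times of `[s, t] ⊆ (α, β)`, with opaque names for the integrand
    have hstS : Icc s t ⊆ Ioo α β := fun σ hσ => hsub ⟨hs.trans hσ.1, hσ.2.trans ht⟩
    obtain ⟨g, hg⟩ : ∃ g : ℝ → ℝ, ∀ σ, g σ = (Δ (swirl (u σ))) x -
        fderiv ℝ (swirl (u σ)) x (u σ x) - 2 / cylRadius x * partialDeriv (eR x) (swirl (u σ)) x :=
      ⟨_, fun _ => rfl⟩
    obtain ⟨F, hF⟩ : ∃ F : ℝ → ℝ, ∀ σ, F σ = swirl (u σ) x := ⟨_, fun _ => rfl⟩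
    have hderiv : ∀ σ ∈ Icc s t, HasDerivAt F (g σ) σ := by
      intro σ hσ
      have hσS : σ ∈ Ioo α β := hstS hσ
      have hw := hsw.hasDerivWithinAt_timeDerivWithin hS hσS x
      have hat : HasDerivAt (fun σ' => swirl (u σ') x) (timeDerivWithin (Ioo α β)
          (fun s => swirl (u s)) σ x) σ := hw.hasDerivAt (isOpen_Ioo.mem_nhds hσS)
      have heq := swirl_transport_holds h haxi hpax hσS hx
      have hc : convect (u σ) (swirl (u σ)) x = fderiv ℝ (swirl (u σ)) x (u σ x) := rfl
      have h0 : swirl ((0 : ℝ → EuclideanSpace ℝ (Fin 3) → EuclideanSpace ℝ (Fin 3)) σ) x = 0 := by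
        simp [swirl]
      rw [hc, h0, add_zero, one_mul] at heq
      have hval : timeDerivWithin (Ioo α β) (fun s => swirl (u s)) σ x = g σ := by
        rw [hg]; linarith
      have eF : (fun σ' => swirl (u σ') x) = F := funext fun σ' => (hF σ').symm
      rw [hval, eF] at hat
      exact hat
    -- the integrand is continuous on `[s, t]`
    have hemb : Continuous fun σ : ℝ => ((σ, x) : ℝ × EuclideanSpace ℝ (Fin 3)) :=
      continuous_id.prodMk continuous_const
    have hmem : ∀ σ ∈ Icc s t, ((σ, x) : ℝ × EuclideanSpace ℝ (Fin 3)) ∈ Ioo α β ×ˢ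
        (univ : Set (EuclideanSpace ℝ (Fin 3))) := fun σ hσ => ⟨hstS hσ, mem_univ _⟩
    -- (the compositions are transported by `congr` + `simp`, not by definitional unfolding,
    -- which would unfold the Laplacian)
    have h1 : ContinuousOn (fun σ : ℝ => (Δ (swirl (u σ))) x) (Icc s t) := by
      have hL := ((hsw.laplacian hS).continuousOn).comp hemb.continuousOn hmem
      refine hL.congr fun σ _ => ?_
      simp only [Function.comp_apply, Function.uncurry_apply_pair]
    have h2 : ContinuousOn (fun σ : ℝ => fderiv ℝ (swirl (u σ)) x) (Icc s t) := by
      have hL := ((hsw.fderiv_slice hS).continuousOn).comp hemb.continuousOn hmem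
      refine hL.congr fun σ _ => ?_
      simp only [Function.comp_apply, Function.uncurry_apply_pair]
    have h3 : ContinuousOn (fun σ : ℝ => u σ x) (Icc s t) := by
      have hL := (hsm.continuousOn).comp hemb.continuousOn hmem
      refine hL.congr fun σ _ => ?_
      simp only [Function.comp_apply, Function.uncurry_apply_pair]
    have hcont : ContinuousOn g (Icc s t) := by
      have e : g = fun σ => (Δ (swirl (u σ))) x - fderiv ℝ (swirl (u σ)) x (u σ x) -
          2 / cylRadius x * fderiv ℝ (swirl (u σ)) x (eR x) := funext fun σ => by rw [hg]; rfl
      rw [e]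
      exact (h1.sub (h2.clm_apply h3)).sub
        (continuousOn_const.mul (h2.clm_apply continuousOn_const))
    have hint : IntervalIntegrable g volume s t := by
      refine (hcont.mono ?_).intervalIntegrable
      rw [uIcc_of_le hst]
    have hFTC := intervalIntegral.integral_eq_sub_of_hasDerivAt
      (fun σ hσ => hderiv σ (by rwa [uIcc_of_le hst] at hσ)) hint
    have eg : (fun σ => (Δ (swirl (u σ))) x - fderiv ℝ (swirl (u σ)) x (u σ x) -
        2 / cylRadius x * partialDeriv (eR x) (swirl (u σ)) x) = g := funext fun σ => (hg σ).symm
    rw [eg, hFTC, hF, hF]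

set_option maxHeartbeats 400000 in
-- the long hypothesis list of `abs_le_of_slab`
/-- **The local bound on `Γ = r u^θ` for classical solutions, up to a potential singular time.**
For every `BMO` bound `K` there is `C ≥ 0` such that: for a classical solution `(u, p)` of the
unforced Navier–Stokes system (`ν = 1`) on `(α, β) × ℝ³` with axisymmetric slices and a stream
function with `BMO` slices bounded by `K`, every slab `[τ − R², τ] ⊆ (α, β)` (`R > 0`) on which
`u` is bounded (by any constant), and all `t ∈ (τ − R²/4, τ)`, `x ∈ B(0, R/2)`:
`|Γ(t, x)| ≤ C R^{-3/2} ‖Γ‖_{L^{10/3}((τ−R²,τ]×B̄(0,R))}`. The constant does not depend on the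
bound for `u`, so for `τ ↑ β` the estimate bounds `Γ` near the axis up to the end of the epoch
by the (finite-energy) `L^{10/3}` norm of `Γ` — the tree's replacement for "the maximum
principle" in the proof of Theorem 1.4 (p. 12).
[cite: LeiZhang2011, §2 (2.6) and §4, proof of Thm. 1.4 (arXiv pp. 8, 12)] -/
theorem abs_swirl_le_local_of_classical (K : ℝ≥0) :
    ∃ C : ℝ, 0 ≤ C ∧ ∀ ⦃α β : ℝ⦄
      ⦃u : ℝ → EuclideanSpace ℝ (Fin 3) → EuclideanSpace ℝ (Fin 3)⦄
      ⦃p : ℝ → EuclideanSpace ℝ (Fin 3) → ℝ⦄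
      ⦃B : ℝ → EuclideanSpace ℝ (Fin 3) → EuclideanSpace ℝ (Fin 3)⦄,
      IsClassicalNSSolutionOn (Ioo α β) 1 0 u p → (∀ t ∈ Ioo α β, IsAxisymmetric (u t)) →
      HasBMOStreamFunctionOn (Ioo α β) u B K →
      ∀ ⦃τ R : ℝ⦄, 0 < R → Icc (τ - R ^ 2) τ ⊆ Ioo α β →
      (∃ Cu : ℝ, ∀ t ∈ Icc (τ - R ^ 2) τ, ∀ x, ‖u t x‖ ≤ Cu) →
      ∀ t ∈ Ioo (τ - (R / 2) ^ 2) τ, ∀ x ∈ ball (0 : EuclideanSpace ℝ (Fin 3)) (R / 2),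
        |swirl (u t) x| ≤ C * R ^ (-(3 / 2 : ℝ)) *
          (eLpNorm (fun q : ℝ × EuclideanSpace ℝ (Fin 3) => |swirl (u q.1) q.2|)
            (ENNReal.ofReal (10 / 3))
            (((volume : Measure ℝ).prod (volume : Measure (EuclideanSpace ℝ (Fin 3)))).restrict
              (Ioc (τ - R ^ 2) τ ×ˢ closedBall (0 : EuclideanSpace ℝ (Fin 3)) R))).toReal := by
  obtain ⟨C, hC0, hC⟩ := abs_le_of_slab K
  refine ⟨C, hC0, ?_⟩
  intro α β u p B h haxi hB τ R hR hsub hbd t ht x hx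
  obtain ⟨Cu, hCu⟩ := hbd
  obtain ⟨h1, hfc, h2, h3, h4, h5, h7, hBae, h11⟩ := swirl_slab_hypotheses h haxi hB hsub
  exact hC hR h1 hfc h2 h3 h4 h5 h7 hCu hBae h11 t ht x hx

end LeiZhang2011

end Literature.Analysis.FluidPDE
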